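import Mathlib.Topology.Instances.ENNReal.Lemmas
import HarnessLib

/-!
# Crux `ModePriceIntegrable` (stmt-AtomisticToContinuum-18512), line `Sketch`:
# the registered stub `stub_switch_of_boundedMode` (stub S, the variational step)

Supports (does not close) stmt-AtomisticToContinuum-18512.

Abstract variational principle in `ℝ≥0∞`: if `E + c = F + M` pointwise on a type `S` and, for
every `δ > 0`, `F` has a `δ`-near-minimiser `Φ_δ` whose collective-mode value is bounded,
`M Φ_δ ≤ B`, then `inf E + c ≤ inf F + B`.  Proof: by `ENNReal.le_of_forall_pos_le_add` it is
enough to show `inf E + c ≤ inf F + B + ε` for every real `ε > 0`; with `Φ = Φ_ε`,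
`inf E + c ≤ E Φ + c = F Φ + M Φ ≤ (inf F + ε) + B`.  No subtraction, no finiteness and no
non-emptiness of `S` is needed (for empty `S` the near-minimiser hypothesis is vacuously false).
[folklore]
-/

namespace Summit.AtomisticToContinuum.BoseEinsteinCondensation.Theorems

/-- **Stub S — the switching energy from a bounded collective mode** (variational principle): if
`E + c = F + M` pointwise and `F` has `δ`-near-minimisers `Φ_δ` with `M(Φ_δ) ≤ B` for every `δ > 0`,
then `inf E + c ≤ inf F + B` (`inf E + c ≤ E(Φ_δ) + c = F(Φ_δ) + M(Φ_δ) ≤ inf F + δ + B`, `δ ↓ 0`).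
[folklore] -/
theorem stub_switch_of_boundedMode : ∀ {S : Type} (E F M : S → ENNReal) (c B : ENNReal), (∀ Ψ, E Ψ + c = F Ψ + M Ψ) → (∀ δ : ENNReal, 0 < δ → ∃ Φ, F Φ ≤ (⨅ Ψ, F Ψ) + δ ∧ M Φ ≤ B) → (⨅ Ψ, E Ψ) + c ≤ (⨅ Ψ, F Ψ) + B := by
  intro S E F M c B hEq hNear
  refine ENNReal.le_of_forall_pos_le_add fun ε hε _ => ?_
  obtain ⟨Φ, hF, hM⟩ := hNear ε (ENNReal.coe_pos.2 hε)
  calc (⨅ Ψ, E Ψ) + c ≤ E Φ + c := add_le_add (iInf_le E Φ) le_rfl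
    _ = F Φ + M Φ := hEq Φ
    _ ≤ (⨅ Ψ, F Ψ) + ε + B := add_le_add hF hM
    _ = (⨅ Ψ, F Ψ) + B + ε := add_right_comm _ _ _

end Summit.AtomisticToContinuum.BoseEinsteinCondensation.Theorems
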